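import Literature.AnabelianGeometry.EtaleTheta.Prop42Sub
import Literature.AnabelianGeometry.EtaleTheta.Discharge.Sec4RootDivisors
import Literature.AnabelianGeometry.EtaleTheta.Discharge.Sec4Model
import HarnessLib

/-!
# [EtTh] Prop. 4.2 (iv): the sub-nodes L07 (Def. 1.3 (iii)(d) half), L08, U1, U2 DISCHARGED, and the
# sharper composition `Prop42_iv ⇐ ZetaA + RootUnitTorsion`

Mochizuki, *The étale theta function …*, Publ. RIMS **45** (2009), §4, Prop. 4.2 (iv), statement PDF p.89
L1–12, proof p.90 L12–24 [cite: MochizukiEtTh2009, Prop 4.2 p.89]. PROOF-ONLY companion (abc-iut cell,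
writer abc-iut-w5-d134) of the sub-DAG statements file `Prop42Sub.lean` (`plan/L2/SUBDAG-EtTh-Prop42.md`,
rows EtTh:Prop4.2(iv)/L07, L08, U1, U2, L07′) over abc-iut-L2-t3's `BiKummerSetting` / `NthRoot` and
abc-iut-L6-t12's `Discharge/Sec4RootDivisors.lean` (`NthRoot.div_num_pow`, `pow_injective_of_isDivisorial`);
nothing there is edited, no definition and no named fact is introduced here.

All theorems hold for EVERY setting `S` modulo the standing [FrdI] Thm. 5.2 (ii) hypotheses `Φ` divisorial,
`B` group-like (the same two hypotheses as abc-iut-L6-t12's `prop42_i_of`): they are bookkeeping in the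
model Frobenioid ([FrdI] Thm. 5.2 (i)(ii); tree `ModelFrobenioid.cancel_left_of_isIso_baseMap`,
`exists_iso_comp_eq_of_div_eq`, `trans_symm_mem_units`, `eq_one_of_mem_units_of_unit_eq_one`, `unitsToRatFn`).
* `betaCompat_of` — L08 `β = β̄ ∘ ζ_B` (pre-steps are epimorphisms: «totally epimorphic»);
* `zetaB_unique_of` — U1;
* `exists_zetaB_num`, `exists_zetaB_den`, `zetaB_upto_unit_of` — L07 up to its `μ_N`-clause: `ζ_B` exists
  and the two denominator squares differ by a unit `u ∈ O^×(B_N)` (torsion-freeness of `Φ` + Def. 1.3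
  (iii)(d));
* `zetaA_unique_upto_mu_of` — U2 (`u := ζ_A' ∘ ζ_A⁻¹ ∈ O^×(A_N)`; `u ∘ α = α`, `deg_Fr α = N` ⇒ `u_u^N = 1`
  by relation (d) ⇒ `u^N = 1`);
* `zetaB_of`, `prop42_iv_of_zetaA_of_rootUnitTorsion` — hence the typed node `BiKummerSetting.Prop42_iv`
  follows from L06 `ZetaA` ([FrdI] Prop. 5.6, merge-gated) and the torsion clause L07′ `RootUnitTorsion`
  alone.
Typed ≠ proved for L06/L07′; nothing here takes a side on [IUTchIII] Cor. 3.12.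
-/

namespace Literature.AnabelianGeometry.EtaleTheta

open CategoryTheory Opposite Literature.AlgebraicGeometry.Frobenioids

universe u₀ v₀ u v w

variable {K : Type u₀} [Field K]

namespace BiKummerSetting

variable {X : SemiGraphs.TemperedArithmeticGroup.{u₀} K} {D₀ : Type u₀} [Category.{v₀} D₀]
  {V : FrdIMonoidStub.{w}} {T : RealifiedDivisorMonoids (D₀ := D₀) V} {D : Type u} [Category.{v} D]
  {VD : FrdICatStub.{u, v, w} D} (S : BiKummerSetting X T D VD)

namespace Prop42Sub

variable (pullFrac : ∀ {A A' : S.C} (_ : A' ⟶ A), S.biratUnits A → S.biratUnits A')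

/-! ### L08 and U1: pre-steps are epimorphisms -/

/-- **(iv)/L08 DISCHARGED** modulo the standing [FrdI] facts `Φ` divisorial, `B` group-like (the hypotheses of
[FrdI] Thm. 5.2 (ii), as in abc-iut-L6-t12's `prop42_i_of`): `β = β̄ ∘ ζ_B`, because both complete the
`s'_N`-square under `s' ∘ α` and the pre-step `s'_N` is an epimorphism («totally epimorphic», [FrdI] Def. 1.3
(v); tree: `ModelFrobenioid.cancel_left_of_isIso_baseMap`). [cite: MochizukiEtTh2009, Prop 4.2 p.89] -/
theorem betaCompat_of (hΦd : Objectwise (fun M _ => IsDivisorial M) S.tf.divisorMonoid)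
    (hBg : Objectwise (fun M _ => IsGroupLike M) S.tf.ratFnFunctor) : BetaCompat S pullFrac := by
  intro B f P N R R' ζA ζB hα hnum
  haveI : IsIso (ModelFrobenioid.baseMap R.pair.num) := R.pair.isPreStep_num.2
  apply ModelFrobenioid.cancel_left_of_isIso_baseMap hΦd hBg R.pair.num
  calc R.pair.num ≫ ζB.hom ≫ R'.β = (ζA.hom ≫ R'.pair.num) ≫ R'.β := by rw [← Category.assoc, ← hnum]
    _ = ζA.hom ≫ R'.α ≫ P.num := by rw [Category.assoc, R'.comm_num]
    _ = R.α ≫ P.num := by rw [← Category.assoc, hα]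
    _ = R.pair.num ≫ R.β := R.comm_num.symm

/-- **(iv)/U1 DISCHARGED** modulo `Φ` divisorial, `B` group-like: `ζ_B` is uniquely determined by `ζ_A` (the
pre-step `s'_N` is an epimorphism). [cite: MochizukiEtTh2009, Prop 4.2 p.89] -/
theorem zetaB_unique_of (hΦd : Objectwise (fun M _ => IsDivisorial M) S.tf.divisorMonoid)
    (hBg : Objectwise (fun M _ => IsGroupLike M) S.tf.ratFnFunctor) : ZetaB_unique S pullFrac := by
  intro B f P N R R' ζA ζB ζB' h h'
  haveI : IsIso (ModelFrobenioid.baseMap R.pair.num) := R.pair.isPreStep_num.2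
  exact Iso.ext (ModelFrobenioid.cancel_left_of_isIso_baseMap hΦd hBg R.pair.num (h.symm.trans h'))

/-- `u_{wᴺ} = (u_w)ᴺ` for `w ∈ O^×(X)` in the model Frobenioid (the homomorphism `O^×(X) → B(X_D)^×`,
[FrdI] Thm. 5.2 (ii); tree `ModelFrobenioid.unitsToRatFn`). [cite: MochizukiFrdI2008, Thm. 5.2(ii) p.101] -/
private theorem unit_pow_hom_of_mem_units {A : S.C} {w : Aut A} (hw : w ∈ ModelFrobenioid.units A)
    (n : ℕ) : ModelFrobenioid.unit (w ^ n).hom = ModelFrobenioid.unit w.hom ^ n := by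
  have h := congrArg (fun x : (S.tf.ratFnFunctor.obj (op A.base))ˣ =>
    (x : S.tf.ratFnFunctor.obj (op A.base)))
    (map_pow (ModelFrobenioid.unitsToRatFn A) ⟨w, hw⟩ n)
  simpa only [Units.val_pow_eq_pow_val, ModelFrobenioid.coe_unitsToRatFn, SubmonoidClass.coe_pow]
    using h

/-- **(iv)/L07, the [FrdI] Def. 1.3 (iii)(d) half, DISCHARGED** modulo `Φ` divisorial, `B` group-like:
given `ζ_A` over `α, ᾱ`, the isomorphism `ζ_B : B_N ⥲ B̄_N` with `s̄'_N ∘ ζ_A = ζ_B ∘ s'_N` EXISTS — because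
`N · Div(s'_N) = α^* Div(s') = ζ_A^*(ᾱ^* Div(s')) = N · ζ_A^* Div(s̄'_N)` and `Φ(A_N)` is torsion-free
(`NthRoot.div_num_pow`, `pow_injective_of_isDivisorial`), so the two pre-steps `s'_N`, `s̄'_N ∘ ζ_A` out of
`A_N` have the same divisor ([FrdI] Thm. 5.2 (ii): `ModelFrobenioid.exists_iso_comp_eq_of_div_eq`).
[cite: MochizukiEtTh2009, Prop 4.2 p.90] -/
theorem exists_zetaB_num (hΦd : Objectwise (fun M _ => IsDivisorial M) S.tf.divisorMonoid)
    (hBg : Objectwise (fun M _ => IsGroupLike M) S.tf.ratFnFunctor)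
    {B : S.C} {f : S.biratUnits S.Aodot} {P : S.FractionPair f B} {N : ℕ+}
    (R R' : S.NthRoot f P N pullFrac) (ζA : R.AN ≅ R'.AN) (hζ : ζA.hom ≫ R'.α = R.α) :
    ∃ ζB : R.BN ≅ R'.BN, ζA.hom ≫ R'.pair.num = R.pair.num ≫ ζB.hom := by
  haveI : IsIso (ModelFrobenioid.baseMap R.pair.num) := R.pair.isPreStep_num.2
  haveI : IsIso (ModelFrobenioid.baseMap R'.pair.num) := R'.pair.isPreStep_num.2
  haveI : IsIso (ModelFrobenioid.baseMap (ζA.hom ≫ R'.pair.num)) := by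
    rw [ModelFrobenioid.baseMap_comp]
    haveI : IsIso (ModelFrobenioid.baseMap ζA.hom) := ModelFrobenioid.isIso_baseMap_of_isIso ζA.hom
    infer_instance
  have hn : ModelFrobenioid.degFr R.pair.num = 1 := R.pair.isPreStep_num.1
  have hn' : ModelFrobenioid.degFr R'.pair.num = 1 := R'.pair.isPreStep_num.1
  have hdeg : ModelFrobenioid.degFr R.pair.num = ModelFrobenioid.degFr (ζA.hom ≫ R'.pair.num) := by
    rw [ModelFrobenioid.degFr_comp, ModelFrobenioid.degFr_eq_one_of_isIso ζA.hom, mul_one, hn, hn']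
  have hdiv : ModelFrobenioid.div R.pair.num = ModelFrobenioid.div (ζA.hom ≫ R'.pair.num) := by
    apply pow_injective_of_isDivisorial (hΦd R.AN.base) N
    rw [R.div_num_pow, ModelFrobenioid.div_comp_of_isIso' hΦd, ← map_pow, R'.div_num_pow, ← pull_comp,
      ← ModelFrobenioid.baseMap_comp, hζ]
  obtain ⟨v, hv⟩ := ModelFrobenioid.exists_iso_comp_eq_of_div_eq hBg R.pair.num (ζA.hom ≫ R'.pair.num)
    hdeg hdiv
  exact ⟨v, hv.symm⟩

/-- The same for the denominators: `ζ_B'' : B_N ⥲ B̄_N` with `s̄''_N ∘ ζ_A = ζ_B'' ∘ s''_N`.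
[cite: MochizukiEtTh2009, Prop 4.2 p.90] -/
theorem exists_zetaB_den (hΦd : Objectwise (fun M _ => IsDivisorial M) S.tf.divisorMonoid)
    (hBg : Objectwise (fun M _ => IsGroupLike M) S.tf.ratFnFunctor)
    {B : S.C} {f : S.biratUnits S.Aodot} {P : S.FractionPair f B} {N : ℕ+}
    (R R' : S.NthRoot f P N pullFrac) (ζA : R.AN ≅ R'.AN) (hζ : ζA.hom ≫ R'.α = R.α) :
    ∃ ζB : R.BN ≅ R'.BN, ζA.hom ≫ R'.pair.den = R.pair.den ≫ ζB.hom := by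
  haveI : IsIso (ModelFrobenioid.baseMap R.pair.den) := R.pair.isPreStep_den.2
  haveI : IsIso (ModelFrobenioid.baseMap R'.pair.den) := R'.pair.isPreStep_den.2
  haveI : IsIso (ModelFrobenioid.baseMap (ζA.hom ≫ R'.pair.den)) := by
    rw [ModelFrobenioid.baseMap_comp]
    haveI : IsIso (ModelFrobenioid.baseMap ζA.hom) := ModelFrobenioid.isIso_baseMap_of_isIso ζA.hom
    infer_instance
  have hn : ModelFrobenioid.degFr R.pair.den = 1 := R.pair.isPreStep_den.1
  have hn' : ModelFrobenioid.degFr R'.pair.den = 1 := R'.pair.isPreStep_den.1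
  have hdeg : ModelFrobenioid.degFr R.pair.den = ModelFrobenioid.degFr (ζA.hom ≫ R'.pair.den) := by
    rw [ModelFrobenioid.degFr_comp, ModelFrobenioid.degFr_eq_one_of_isIso ζA.hom, mul_one, hn, hn']
  have hdiv : ModelFrobenioid.div R.pair.den = ModelFrobenioid.div (ζA.hom ≫ R'.pair.den) := by
    apply pow_injective_of_isDivisorial (hΦd R.AN.base) N
    rw [R.div_den_pow, ModelFrobenioid.div_comp_of_isIso' hΦd, ← map_pow, R'.div_den_pow, ← pull_comp,
      ← ModelFrobenioid.baseMap_comp, hζ]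
  obtain ⟨v, hv⟩ := ModelFrobenioid.exists_iso_comp_eq_of_div_eq hBg R.pair.den (ζA.hom ≫ R'.pair.den)
    hdeg hdiv
  exact ⟨v, hv.symm⟩

/-- **(iv)/L07 up to the `μ_N`-clause, DISCHARGED** modulo `Φ` divisorial, `B` group-like: given `ζ_A` over
`α, ᾱ` there are `ζ_B : B_N ⥲ B̄_N` and a UNIT `u ∈ O^×(B_N)` with `s̄'_N ∘ ζ_A = ζ_B ∘ s'_N` and
`s̄''_N ∘ ζ_A = ζ_B ∘ u ∘ s''_N` (`u := ζ_B'' ∘ ζ_B⁻¹` for the two isomorphisms of `exists_zetaB_num/den`;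
same base because `s'_N, s''_N` and `s̄'_N, s̄''_N` are base-equivalent). What remains of `ZetaB` is exactly
print's «`u ∈ μ_N(B_N)`», i.e. `u^N = 1` — the comparison of the two roots' fractions `g^N = f|` ,
`ḡ^N = f|` through the birational dictionary (row L07 residual). [cite: MochizukiEtTh2009, Prop 4.2 p.90] -/
theorem zetaB_upto_unit_of (hΦd : Objectwise (fun M _ => IsDivisorial M) S.tf.divisorMonoid)
    (hBg : Objectwise (fun M _ => IsGroupLike M) S.tf.ratFnFunctor)
    {B : S.C} {f : S.biratUnits S.Aodot} {P : S.FractionPair f B} {N : ℕ+}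
    (R R' : S.NthRoot f P N pullFrac) (ζA : R.AN ≅ R'.AN) (hζ : ζA.hom ≫ R'.α = R.α) :
    ∃ (u : Aut R.BN) (ζB : R.BN ≅ R'.BN), u ∈ S.units R.BN ∧
      ζA.hom ≫ R'.pair.num = R.pair.num ≫ ζB.hom ∧
        ζA.hom ≫ R'.pair.den = (R.pair.den ≫ u.hom) ≫ ζB.hom := by
  obtain ⟨ζB, hB⟩ := exists_zetaB_num S pullFrac hΦd hBg R R' ζA hζ
  obtain ⟨ζB'', hB''⟩ := exists_zetaB_den S pullFrac hΦd hBg R R' ζA hζ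
  haveI : IsIso (ModelFrobenioid.baseMap R.pair.num) := R.pair.isPreStep_num.2
  have hbase : ModelFrobenioid.baseMap ζB''.hom = ModelFrobenioid.baseMap ζB.hom := by
    have h1 := congrArg ModelFrobenioid.baseMap hB
    have h2 := congrArg ModelFrobenioid.baseMap hB''
    rw [ModelFrobenioid.baseMap_comp, ModelFrobenioid.baseMap_comp] at h1 h2
    have hRb : ModelFrobenioid.baseMap R.pair.den = ModelFrobenioid.baseMap R.pair.num := R.pair.base_eq.symm
    have hR'b : ModelFrobenioid.baseMap R'.pair.den = ModelFrobenioid.baseMap R'.pair.num :=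
      R'.pair.base_eq.symm
    rw [hRb, hR'b] at h2
    exact (cancel_epi (ModelFrobenioid.baseMap R.pair.num)).mp (h2.symm.trans h1)
  refine ⟨ζB'' ≪≫ ζB.symm, ζB, ?_, hB, ?_⟩
  · have hu := ModelFrobenioid.trans_symm_mem_units ζB'' ζB hbase
    exact ⟨hu.1, hu.2⟩
  · rw [Iso.trans_hom, Iso.symm_hom, Category.assoc, Category.assoc, Iso.inv_hom_id, Category.comp_id]
    exact hB''

/-- **(iv)/U2 DISCHARGED** modulo `Φ` divisorial, `B` group-like: two isomorphisms `ζ_A, ζ_A' : A_N ⥲ Ā_N`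
over `α, ᾱ` with the same base differ by `u := ζ_A' ∘ ζ_A⁻¹ ∈ μ_N(A_N)` — `u ∈ O^×(A_N)` (same base,
[FrdI] Thm. 5.2 (ii)), and `u ∘ α = α` with `deg_Fr(α) = N` forces `u_u^N = 1` in `B(A_N^bs)` (relation (d)
of Thm. 5.2 (i)), whence `u^N = 1`. [cite: MochizukiEtTh2009, Prop 4.2 p.89] -/
theorem zetaA_unique_upto_mu_of (hΦd : Objectwise (fun M _ => IsDivisorial M) S.tf.divisorMonoid)
    (hBg : Objectwise (fun M _ => IsGroupLike M) S.tf.ratFnFunctor) :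
    ZetaA_unique_upto_mu S pullFrac := by
  intro B f P N R R' ζA ζA' hζ hζ' hbs
  have hb : ModelFrobenioid.baseMap ζA'.hom = ModelFrobenioid.baseMap ζA.hom :=
    (congrArg Iso.hom hbs).symm
  set u : Aut R.AN := ζA' ≪≫ ζA.symm with hu_def
  have hu : u ∈ ModelFrobenioid.units R.AN := ModelFrobenioid.trans_symm_mem_units ζA' ζA hb
  have hcomp : u.hom ≫ R.α = R.α := by
    calc u.hom ≫ R.α = ζA'.hom ≫ ζA.inv ≫ R.α := by
          rw [hu_def, Iso.trans_hom, Iso.symm_hom, Category.assoc]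
      _ = ζA'.hom ≫ ζA.inv ≫ ζA.hom ≫ R'.α := by rw [hζ]
      _ = ζA'.hom ≫ R'.α := by rw [Iso.inv_hom_id_assoc]
      _ = R.α := hζ'
  haveI : IsCancelMul (S.tf.ratFnFunctor.obj (op R.AN.base)) :=
    isIntegral_iff_isCancelMul.mp (hBg R.AN.base).isPreDivisorial.isIntegral
  have hN : ModelFrobenioid.degFr R.α = N := R.isIsometry.2.2.1
  have hunit : ModelFrobenioid.unit u.hom ^ (N : ℕ) = 1 := by
    have h := congrArg ModelFrobenioid.unit hcomp
    rw [ModelFrobenioid.unit_comp, hu.1, ModelFrobenioid.map_id_apply_B, hN] at h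
    exact mul_left_cancel (h.trans (mul_one _).symm)
  have hpow : u ^ (N : ℕ) = 1 :=
    ModelFrobenioid.eq_one_of_mem_units_of_unit_eq_one hΦd (pow_mem hu _)
      (by rw [unit_pow_hom_of_mem_units S hu, hunit])
  refine ⟨⟨u, ⟨hu.1, hu.2⟩, hpow⟩, ?_⟩
  change ζA' = (ζA' ≪≫ ζA.symm) ≪≫ ζA
  rw [Iso.trans_assoc, Iso.symm_self_id, Iso.trans_refl]

/-- **L07 ⇐ L07′** modulo `Φ` divisorial, `B` group-like: `ZetaB` follows from the torsion clause alone
(the isomorphism `ζ_B` and the unit `u` being supplied by `zetaB_upto_unit_of`). PROVED.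
[cite: MochizukiEtTh2009, Prop 4.2 p.90] -/
theorem zetaB_of (hΦd : Objectwise (fun M _ => IsDivisorial M) S.tf.divisorMonoid)
    (hBg : Objectwise (fun M _ => IsGroupLike M) S.tf.ratFnFunctor) (hμ : RootUnitTorsion S pullFrac) :
    ZetaB S pullFrac := by
  intro B f P N R R' ζA hζ
  obtain ⟨u, ζB, hu, hnum, hden⟩ := zetaB_upto_unit_of S pullFrac hΦd hBg R R' ζA hζ
  exact ⟨⟨u, hu, hμ f P N R R' ζA ζB u hu hζ hnum hden⟩, ζB, hnum, hden⟩

/-- **Sharper composition for Prop. 4.2 (iv)**: modulo the standing [FrdI] Thm. 5.2 (ii) hypotheses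
(`Φ` divisorial, `B` group-like), the typed node `BiKummerSetting.Prop42_iv` follows from L06 `ZetaA`
(existence of `ζ_A`: uniqueness of base-Frobenius pairs, [FrdI] Prop. 5.6 — merge-gated) and L07′
`RootUnitTorsion` (the `μ_N`-clause) ALONE; L07's isomorphism and L08 are theorems above. PROVED.
[cite: MochizukiEtTh2009, Prop 4.2 p.89] -/
theorem prop42_iv_of_zetaA_of_rootUnitTorsion
    (hΦd : Objectwise (fun M _ => IsDivisorial M) S.tf.divisorMonoid)
    (hBg : Objectwise (fun M _ => IsGroupLike M) S.tf.ratFnFunctor)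
    (h₆ : ZetaA S pullFrac) (hμ : RootUnitTorsion S pullFrac) : S.Prop42_iv pullFrac :=
  prop42_iv_of_subnodes S pullFrac h₆ (zetaB_of S pullFrac hΦd hBg hμ) (betaCompat_of S pullFrac hΦd hBg)

/-! ### L07′ `RootUnitTorsion` modulo the birational dictionary of [FrdI] Thm. 5.2 (ii) -/

/-- **(iv)/L07′ DISCHARGED modulo [FrdI] facts**: `Φ` divisorial, `B` group-like, and a DICTIONARY
`toB : O^×(A^birat) → B(A_D)^×` computing fractions (`toB(s'·(s'')⁻¹) · u_{s''} = u_{s'}`) and compatible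
with the transport `pullFrac` (`toB(((φ)^birat)^* x) = Base(φ)^* toB(x)`) — [FrdI] Thm. 5.2 (ii) "`O^×(−)` on
`C^birat` is `B(−)`", the identity for abc-iut-L2-t9's `mkOfModel`/`pullFracModel`. PROOF (print p.89 L4
«for some `u ∈ μ_N(B_N)`»): reading the units `u_(−)` of the two squares gives
`Base(ζ_A)^* f̄_N · Base(s'_N)^* u_u = f_N` in `B(A_N^bs)`; raising to the `N`-th power and using
`f_N^N = (α')^* f`, `f̄_N^N = (ᾱ')^* f`, `ᾱ^bs ∘ ζ_A^bs = α^bs` kills everything but `Base(s'_N)^*(u_u^N) = 1`,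
whence `u_u^N = 1` and `u^N = 1`. [cite: MochizukiEtTh2009, Prop 4.2 p.89] -/
theorem rootUnitTorsion_of (hΦd : Objectwise (fun M _ => IsDivisorial M) S.tf.divisorMonoid)
    (hBg : Objectwise (fun M _ => IsGroupLike M) S.tf.ratFnFunctor)
    (toB : ∀ A : S.C, S.biratUnits A →* (S.tf.ratFnFunctor.obj (op A.base))ˣ)
    (hfrac : ∀ {A B : S.C} (s' s'' : A ⟶ B) (h' : S.IsPreStep s') (h'' : S.IsPreStep s'')
      (hb : PreFrobenioid.BaseEquivalent S.F s' s''),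
      (toB A (S.fracOf s' s'' h' h'' hb) : S.tf.ratFnFunctor.obj (op A.base)) *
        ModelFrobenioid.unit s'' = ModelFrobenioid.unit s')
    (hpull : ∀ {A A' : S.C} (φ : A' ⟶ A) (x : S.biratUnits A),
      (toB A' (pullFrac φ x) : S.tf.ratFnFunctor.obj (op A'.base)) =
        pull S.tf.ratFnFunctor (ModelFrobenioid.baseMap φ) (toB A x)) :
    RootUnitTorsion S pullFrac := by
  intro B f P N R R' ζA ζB u hu hζ hnum hden
  haveI : IsCancelMul (S.tf.ratFnFunctor.obj (op R.AN.base)) :=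
    isIntegral_iff_isCancelMul.mp (hBg R.AN.base).isPreDivisorial.isIntegral
  have hu' : u ∈ ModelFrobenioid.units R.BN := ⟨hu.1, hu.2⟩
  haveI : IsIso (ModelFrobenioid.baseMap R.pair.num) := R.pair.isPreStep_num.2
  -- degrees and bases
  have hn1' : ModelFrobenioid.degFr R'.pair.num = 1 := R'.pair.isPreStep_num.1
  have hd1' : ModelFrobenioid.degFr R'.pair.den = 1 := R'.pair.isPreStep_den.1
  have hζ1 : ModelFrobenioid.degFr ζB.hom = 1 := ModelFrobenioid.degFr_eq_one_of_isIso ζB.hom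
  have hub : ModelFrobenioid.baseMap u.hom = 𝟙 _ := hu'.1
  have hu1 : ModelFrobenioid.degFr u.hom = 1 := hu'.2
  have hbe : ModelFrobenioid.baseMap R.pair.den = ModelFrobenioid.baseMap R.pair.num := R.pair.base_eq.symm
  -- the fractions `f_N`, `f̄_N` read in `B`
  have hg : (toB R.AN R.root : S.tf.ratFnFunctor.obj (op R.AN.base)) * ModelFrobenioid.unit R.pair.den =
      ModelFrobenioid.unit R.pair.num := by
    have h := hfrac R.pair.num R.pair.den R.pair.isPreStep_num R.pair.isPreStep_den R.pair.base_eq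
    rwa [R.pair.frac_eq] at h
  have hg' : (toB R'.AN R'.root : S.tf.ratFnFunctor.obj (op R'.AN.base)) * ModelFrobenioid.unit R'.pair.den =
      ModelFrobenioid.unit R'.pair.num := by
    have h := hfrac R'.pair.num R'.pair.den R'.pair.isPreStep_num R'.pair.isPreStep_den R'.pair.base_eq
    rwa [R'.pair.frac_eq] at h
  -- the units of the two squares
  have E1 := congrArg ModelFrobenioid.unit hnum
  rw [ModelFrobenioid.unit_comp_pull, ModelFrobenioid.unit_comp_pull, hn1', hζ1, PNat.one_coe, pow_one,
    pow_one] at E1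
  have E2 := congrArg ModelFrobenioid.unit hden
  rw [ModelFrobenioid.unit_comp_pull, ModelFrobenioid.unit_comp_pull, ModelFrobenioid.unit_comp_pull, hd1',
    hζ1, hu1, PNat.one_coe, pow_one, pow_one, pow_one, ModelFrobenioid.baseMap_comp, hub,
    Category.comp_id, hbe] at E2
  -- (†'): `Base(ζ_A)^* f̄_N · Base(s'_N)^* u_u = f_N`
  set Z := pull S.tf.ratFnFunctor (ModelFrobenioid.baseMap ζA.hom) with hZ
  set Sn := pull S.tf.ratFnFunctor (ModelFrobenioid.baseMap R.pair.num) with hSn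
  have key : Z (toB R'.AN R'.root : S.tf.ratFnFunctor.obj (op R'.AN.base)) * Sn (ModelFrobenioid.unit u.hom) =
      (toB R.AN R.root : S.tf.ratFnFunctor.obj (op R.AN.base)) := by
    have hZg : Z (toB R'.AN R'.root : _) * Z (ModelFrobenioid.unit R'.pair.den) =
        Z (ModelFrobenioid.unit R'.pair.num) := by rw [← map_mul, hg']
    -- multiply E2 by Z(f̄_N) and compare with E1 · (toB f_N relation)
    have h1 : Z (toB R'.AN R'.root : _) * (Sn (ModelFrobenioid.unit ζB.hom) *
        (Sn (ModelFrobenioid.unit u.hom) * ModelFrobenioid.unit R.pair.den)) =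
        Sn (ModelFrobenioid.unit ζB.hom) * ModelFrobenioid.unit R.pair.num := by
      rw [← E2, ← mul_assoc, hZg, E1]
    have h2 : Sn (ModelFrobenioid.unit ζB.hom) * ModelFrobenioid.unit R.pair.num =
        Sn (ModelFrobenioid.unit ζB.hom) * ModelFrobenioid.unit R.pair.den *
          (toB R.AN R.root : S.tf.ratFnFunctor.obj (op R.AN.base)) := by
      rw [← hg, mul_assoc, mul_comm (ModelFrobenioid.unit R.pair.den)]
    have h3 : Sn (ModelFrobenioid.unit ζB.hom) * ModelFrobenioid.unit R.pair.den *
        (Z (toB R'.AN R'.root : _) * Sn (ModelFrobenioid.unit u.hom)) =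
        Sn (ModelFrobenioid.unit ζB.hom) * ModelFrobenioid.unit R.pair.den *
          (toB R.AN R.root : S.tf.ratFnFunctor.obj (op R.AN.base)) := by
      rw [← h2, ← h1]
      ac_rfl
    exact mul_left_cancel h3
  -- `N`-th powers: `f_N^N = (α')^* f` and `Base(ζ_A)^*(f̄_N^N) = (α')^* f`
  have hbα : ModelFrobenioid.baseMap R.α = ModelFrobenioid.baseMap R.αData.α₁ := by
    have hc : ModelFrobenioid.baseMap R.αData.α₂ = 𝟙 _ := R.αData.cond_c.1
    have h := congrArg ModelFrobenioid.baseMap R.αData.fac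
    rw [ModelFrobenioid.baseMap_comp, hc, Category.id_comp] at h
    exact h.symm
  have hbα' : ModelFrobenioid.baseMap R'.α = ModelFrobenioid.baseMap R'.αData.α₁ := by
    have hc : ModelFrobenioid.baseMap R'.αData.α₂ = 𝟙 _ := R'.αData.cond_c.1
    have h := congrArg ModelFrobenioid.baseMap R'.αData.fac
    rw [ModelFrobenioid.baseMap_comp, hc, Category.id_comp] at h
    exact h.symm
  have hbζ : ModelFrobenioid.baseMap ζA.hom ≫ ModelFrobenioid.baseMap R'.αData.α₁ =
      ModelFrobenioid.baseMap R.αData.α₁ := by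
    rw [← hbα', ← hbα, ← ModelFrobenioid.baseMap_comp, hζ]
  have hgN : (toB R.AN R.root : S.tf.ratFnFunctor.obj (op R.AN.base)) ^ (N : ℕ) =
      pull S.tf.ratFnFunctor (ModelFrobenioid.baseMap R.αData.α₁)
        (toB S.Aodot f : S.tf.ratFnFunctor.obj (op S.Aodot.base)) := by
    rw [← Units.val_pow_eq_pow_val, ← map_pow, R.pow_root, hpull]
  have hgN' : Z (toB R'.AN R'.root : S.tf.ratFnFunctor.obj (op R'.AN.base)) ^ (N : ℕ) =
      pull S.tf.ratFnFunctor (ModelFrobenioid.baseMap R.αData.α₁)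
        (toB S.Aodot f : S.tf.ratFnFunctor.obj (op S.Aodot.base)) := by
    rw [← map_pow, ← Units.val_pow_eq_pow_val, ← map_pow, R'.pow_root, hpull, hZ, ← pull_comp, hbζ]
  -- conclude: `Base(s'_N)^*(u_u^N) = 1`, hence `u_u^N = 1`, hence `u^N = 1`
  have hSN : Sn (ModelFrobenioid.unit u.hom ^ (N : ℕ)) = 1 := by
    have h := congrArg (fun x => x ^ (N : ℕ)) key
    simp only [mul_pow] at h
    rw [hgN', hgN, ← map_pow] at h
    exact mul_left_cancel (h.trans (mul_one _).symm)
  have huN : ModelFrobenioid.unit u.hom ^ (N : ℕ) = 1 := by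
    apply PreFrobenioid.pull_injective (Φ := S.tf.ratFnFunctor) (ModelFrobenioid.baseMap R.pair.num)
    rw [← hSn, hSN, map_one]
  exact ModelFrobenioid.eq_one_of_mem_units_of_unit_eq_one hΦd (pow_mem hu' _)
    (by rw [unit_pow_hom_of_mem_units S hu', huN])

/-- **[EtTh] Prop. 4.2 (iv) AS TYPED ⇐ L06 `ZetaA` alone**, modulo the [FrdI] Thm. 5.2 (ii) facts (`Φ` divisorial,
`B` group-like, the birational dictionary `toB` with its fraction and transport laws): L07 (with L07′), L08 are
theorems above, so the typed node `BiKummerSetting.Prop42_iv` follows from the existence of `ζ_A` ([FrdI]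
Prop. 5.6 uniqueness of base-Frobenius pairs + Rmk. 4.1.1 + Thm. 5.1 (iii) — the merge-gated input).
[cite: MochizukiEtTh2009, Prop 4.2 p.89] -/
theorem prop42_iv_of_zetaA (hΦd : Objectwise (fun M _ => IsDivisorial M) S.tf.divisorMonoid)
    (hBg : Objectwise (fun M _ => IsGroupLike M) S.tf.ratFnFunctor)
    (toB : ∀ A : S.C, S.biratUnits A →* (S.tf.ratFnFunctor.obj (op A.base))ˣ)
    (hfrac : ∀ {A B : S.C} (s' s'' : A ⟶ B) (h' : S.IsPreStep s') (h'' : S.IsPreStep s'')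
      (hb : PreFrobenioid.BaseEquivalent S.F s' s''),
      (toB A (S.fracOf s' s'' h' h'' hb) : S.tf.ratFnFunctor.obj (op A.base)) *
        ModelFrobenioid.unit s'' = ModelFrobenioid.unit s')
    (hpull : ∀ {A A' : S.C} (φ : A' ⟶ A) (x : S.biratUnits A),
      (toB A' (pullFrac φ x) : S.tf.ratFnFunctor.obj (op A'.base)) =
        pull S.tf.ratFnFunctor (ModelFrobenioid.baseMap φ) (toB A x))
    (h₆ : ZetaA S pullFrac) : S.Prop42_iv pullFrac :=
  prop42_iv_of_zetaA_of_rootUnitTorsion S pullFrac hΦd hBg h₆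
    (rootUnitTorsion_of S pullFrac hΦd hBg toB hfrac hpull)

end Prop42Sub

/-- **[EtTh] Prop. 4.2 (iv) for the MODEL INSTANCE** `mkOfModel` of the §4 setting (abc-iut-L2-t9: `O^×(A^birat)
:= B(A_D)^×`, `s'·(s'')⁻¹ := u_{s'}·u_{s''}⁻¹`, transport `pullFracModel`; dictionary = identity): given `Φ`
divisorial, Prop. 4.2 (iv) AS TYPED holds as soon as the `ζ_A` of its proof exist (sub-node L06 `ZetaA`).
[cite: MochizukiEtTh2009, Prop 4.2 p.89] -/
theorem prop42_iv_mkOfModel_of_zetaA (tf : TemperedFrobenioid T D VD) (hZ : tf.monoidType = MonoidType.Z)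
    (hP : ∀ A : Dᵒᵖ, IsPerfect (tf.Φ.carrier A)) (hBΛ : ∀ (Y : D₀ᵒᵖ) (b : T.BΛ.obj Y), IsUnit b)
    (DS : ∀ {A : Dᵒᵖ}, tf.Φ.carrier A → tf.Φ.carrier A → Prop) (IG : D → Prop)
    (gS : ∀ A : D, IG A → (X.Pi →* Aut A)) (gSs : ∀ (A : D) (h : IG A), Function.Surjective (gS A h))
    (NH : Subgroup (Field.absoluteGaloisGroup K) → tf.category → ℕ+ → Prop)
    (AB : ∀ {A B : tf.category}, Subgroup (Aut A) → (A ⟶ A) → (A ⟶ B) → Prop) (A₀ : tf.category)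
    (hA₀ : PreFrobenioid.IsFrobeniusTrivial tf.toElem A₀) (hA₀' : IG A₀.base)
    (hΦd : Objectwise (fun M _ => IsDivisorial M) tf.divisorMonoid)
    (h₆ : Prop42Sub.ZetaA (mkOfModel X tf hZ hP hBΛ DS IG gS gSs NH AB A₀ hA₀ hA₀')
      (fun φ x => tf.pullFracModel φ x)) :
    (mkOfModel X tf hZ hP hBΛ DS IG gS gSs NH AB A₀ hA₀ hA₀').Prop42_iv (fun φ x => tf.pullFracModel φ x) := by
  intro B f P N R R' ebs h
  exact Prop42Sub.prop42_iv_of_zetaA (mkOfModel X tf hZ hP hBΛ DS IG gS gSs NH AB A₀ hA₀ hA₀')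
    (fun φ x => tf.pullFracModel φ x) hΦd (tf.isGroupLike_ratFnFunctor hBΛ)
    (fun A => MonoidHom.id (tf.biratUnitsModel A))
    (fun s' s'' _ _ _ => coe_fracOfModel_mul_unit tf hBΛ s' s'') (fun _ _ => rfl) h₆ f P N R R' ebs h


end BiKummerSetting

end Literature.AnabelianGeometry.EtaleTheta
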